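import Summits.HodgeConjecture.CorCM.IrreducibleOddWeightsCommutantCentre
import Summits.HodgeConjecture.CorCM.IrreducibleOddWeightsCommutantBases
import HarnessLib

/-!
# Density over the commutant, XV: THE DEGREE OF THE CENTRE DIVIDES `δ` — `dim Z|_A ∣ dim 𝒟|_A`, through the
# enlarged operator family `⟨T, 𝒟⟩` whose commutant on `A` is exactly the centre

COR-CM (cell `pub-hodgecm2`, binder seat `b16` gen 74, count-neutral claim THE CENTRE, file Z2 — abstract linear
algebra over `ℚ`; theorems only, no definition, no named fact, no `sorry`).  NEW as stated, hence under `Summits/`.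
HONEST FRAMING: `𝒟|_A` is a vector space over the field `Z|_A` (file Z1), so `[Z|_A : ℚ]` divides `δ = dim_ℚ 𝒟|_A`;
here this is obtained WITHOUT building the field structure, by re-running gen 72's Schur/exchange machinery (files
C1–C3, K1) for the ENLARGED FAMILY `T♯` — the submonoid of `End V` generated by the operators `T_i` AND the
commutant `𝒟` — for which `A` is again stable and irreducible and whose commutant on `A` is PRECISELY the centre
`𝒟 ⊓ ℬ`: the centre's «lines» `Z·a` then all have one dimension `ζ`, and `ζ` divides the dimension of every
`Z`-stable subspace of `A`, in particular of the D-line `D·a₀` (dimension `δ`).  The quotient `δ/ζ` is the square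
of the Schur index times … — NOT formalised.  Nothing about Hodge classes is asserted; `HC_CM` is neither used nor
asserted.

* §1 THE ENLARGED FAMILY `T♯ = Submonoid.closure (range T ∪ 𝒟)` (coerced to operators): contains `id`, closed under
  composition, preserves `A` (`closure_apply_mem`), `A` irreducible for it; **`mem_centre_iff_commute_closure`**: its
  commutant on `A` is the centre `𝒟 ⊓ ℬ`.
* §2 **`finrank_map_applyₗ_centre_dvd_finrank_map_applyₗ`: `dim Z·a₀ ∣ dim D·a₀`** (`ζ ∣ δ`),
  `finrank_map_domRestrict'_centre_eq` (`dim Z|_A = ζ`), **`finrank_map_domRestrict'_centre_dvd`: `dim Z|_A ∣ δ`**,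
  `finrank_map_domRestrict'_centre_dvd_finrank` (`dim Z|_A ∣ dim A`), `finrank_map_applyₗ_centre_eq` (all `Z`-lines of
  non-zero elements of `A` have dimension `ζ`); appended: `finrank_map_domRestrict'_centre_dvd_span` (**`dim Z|_A ∣ dim span(T)|_A`**).

## References

* [CurtisReiner1962] C. W. Curtis, I. Reiner, *Representation Theory of Finite Groups and Associative Algebras*,
  §27 (27.3), §59, §68 (central simple algebras).
* [Lang2002] S. Lang, *Algebra*, 3rd ed., XVII §1 Prop. 1.1, XVII §3.
* [Herstein1994] I. N. Herstein, *Noncommutative Rings*, Carus Math. Monographs 15, §4.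
-/

set_option autoImplicit false

noncomputable section

open scoped BigOperators Classical

universe v w

namespace Summit.HodgeConjecture.CorCM.IrrOdd

variable {V : Type v} [AddCommGroup V] [Module ℚ V] {ι : Type w} (T : ι → V →ₗ[ℚ] V)

/-! ### §1 The enlarged family `⟨T, 𝒟⟩` and its commutant -/

/-- The enlarged family contains the identity. [folklore] -/
theorem exists_closure_eq_id (𝒟 : Submodule ℚ (V →ₗ[ℚ] V)) :
    ∃ m : ↥(Submonoid.closure (Set.range T ∪ (𝒟 : Set (V →ₗ[ℚ] V)))), (m : V →ₗ[ℚ] V) = LinearMap.id :=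
  ⟨⟨1, Submonoid.one_mem _⟩, rfl⟩

/-- The enlarged family is closed under composition. [folklore] -/
theorem exists_closure_eq_comp (𝒟 : Submodule ℚ (V →ₗ[ℚ] V))
    (m m' : ↥(Submonoid.closure (Set.range T ∪ (𝒟 : Set (V →ₗ[ℚ] V))))) :
    ∃ m'' : ↥(Submonoid.closure (Set.range T ∪ (𝒟 : Set (V →ₗ[ℚ] V)))),
      (m'' : V →ₗ[ℚ] V) = (m : V →ₗ[ℚ] V) ∘ₗ (m' : V →ₗ[ℚ] V) :=
  ⟨⟨m.1 * m'.1, Submonoid.mul_mem _ m.2 m'.2⟩, rfl⟩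

/-- **The enlarged family preserves `A`** (its generators `T_i` and `L ∈ 𝒟` do). [cite: CurtisReiner1962, §59] -/
theorem closure_apply_mem {𝒟 : Submodule ℚ (V →ₗ[ℚ] V)} {A : Submodule ℚ V}
    (h𝒟 : ∀ L : V →ₗ[ℚ] V, L ∈ 𝒟 ↔ (∀ a ∈ A, L a ∈ A) ∧ ∀ (i : ι) (a : V), a ∈ A → L (T i a) = T i (L a))
    (hAst : ∀ (i : ι) (v : V), v ∈ A → T i v ∈ A) {m : V →ₗ[ℚ] V}
    (hm : m ∈ Submonoid.closure (Set.range T ∪ (𝒟 : Set (V →ₗ[ℚ] V)))) :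
    ∀ v ∈ A, m v ∈ A := by
  induction hm using Submonoid.closure_induction with
  | mem x hx =>
    rcases hx with ⟨i, rfl⟩ | hxD
    · exact fun v hv => hAst i v hv
    · exact ((h𝒟 x).1 hxD).1
  | one => exact fun v hv => hv
  | mul x y _ _ ihx ihy => exact fun v hv => ihx _ (ihy v hv)

/-- `A` is irreducible for the enlarged family (it is for `T` alone). [cite: Lang2002, XVII §1] -/
theorem closure_irreducible {𝒟 : Submodule ℚ (V →ₗ[ℚ] V)} {A : Submodule ℚ V}
    (hAirr : ∀ W : Submodule ℚ V, W ≤ A → W ≠ ⊥ → (∀ (i : ι) (v : V), v ∈ W → T i v ∈ W) → W = A)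
    (W : Submodule ℚ V) (hW : W ≤ A) (hW0 : W ≠ ⊥)
    (hWst : ∀ (m : ↥(Submonoid.closure (Set.range T ∪ (𝒟 : Set (V →ₗ[ℚ] V))))) (v : V),
      v ∈ W → (m : V →ₗ[ℚ] V) v ∈ W) :
    W = A :=
  hAirr W hW hW0 fun i v hv => hWst ⟨T i, Submonoid.subset_closure (Or.inl ⟨i, rfl⟩)⟩ v hv

/-- **THE COMMUTANT OF `⟨T, 𝒟⟩` ON `A` IS THE CENTRE**: `ψ ∈ 𝒟 ⊓ ℬ` iff `ψ(A) ⊆ A` and `ψ` commutes on `A` with every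
element of the submonoid generated by the `T_i` and `𝒟`. [cite: CurtisReiner1962, §59] [cite: Herstein1994, §4] -/
theorem mem_centre_iff_commute_closure {𝒟 ℬ : Submodule ℚ (V →ₗ[ℚ] V)} {A : Submodule ℚ V}
    (h𝒟 : ∀ L : V →ₗ[ℚ] V, L ∈ 𝒟 ↔ (∀ a ∈ A, L a ∈ A) ∧ ∀ (i : ι) (a : V), a ∈ A → L (T i a) = T i (L a))
    (hℬ : ∀ ψ : V →ₗ[ℚ] V, ψ ∈ ℬ ↔ (∀ a ∈ A, ψ a ∈ A) ∧
      ∀ (L : ↥𝒟) (a : V), a ∈ A → ψ ((L : V →ₗ[ℚ] V) a) = (L : V →ₗ[ℚ] V) (ψ a))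
    (hAst : ∀ (i : ι) (v : V), v ∈ A → T i v ∈ A) (ψ : V →ₗ[ℚ] V) :
    ψ ∈ 𝒟 ⊓ ℬ ↔ (∀ a ∈ A, ψ a ∈ A) ∧
      ∀ (m : ↥(Submonoid.closure (Set.range T ∪ (𝒟 : Set (V →ₗ[ℚ] V))))) (a : V), a ∈ A →
        ψ ((m : V →ₗ[ℚ] V) a) = (m : V →ₗ[ℚ] V) (ψ a) := by
  rw [mem_commutant_inf_bicommutant_iff T h𝒟 hℬ]
  constructor
  · rintro ⟨hψ𝒟, hψc⟩
    obtain ⟨hψA, hψT⟩ := (h𝒟 ψ).1 hψ𝒟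
    refine ⟨hψA, fun m => ?_⟩
    obtain ⟨m, hm⟩ := m
    induction hm using Submonoid.closure_induction with
    | mem x hx =>
      rcases hx with ⟨i, rfl⟩ | hxD
      · exact fun a ha => hψT i a ha
      · exact fun a ha => hψc x hxD a ha
    | one => exact fun a _ => rfl
    | mul x y _ hy ihx ihy =>
      intro a ha
      change ψ (x (y a)) = x (y (ψ a))
      rw [ihx _ (closure_apply_mem T h𝒟 hAst hy a ha), ihy a ha]
  · rintro ⟨hψA, hψc⟩
    refine ⟨(h𝒟 ψ).2 ⟨hψA, fun i a ha => ?_⟩, fun L hL a ha => ?_⟩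
    · exact hψc ⟨T i, Submonoid.subset_closure (Or.inl ⟨i, rfl⟩)⟩ a ha
    · exact hψc ⟨L, Submonoid.subset_closure (Or.inr hL)⟩ a ha

/-! ### §2 The degree of the centre divides `δ` -/

/-- **ALL CENTRE LINES HAVE ONE DIMENSION `ζ`**: `dim Z·a = dim Z·a′` for `a, a′ ≠ 0` in `A` (file C1 for `⟨T, 𝒟⟩`).
[cite: Lang2002, XVII §1 Prop. 1.1] [cite: CurtisReiner1962, §27 (27.3)] -/
theorem finrank_map_applyₗ_centre_eq {𝒟 ℬ : Submodule ℚ (V →ₗ[ℚ] V)} {A : Submodule ℚ V} [FiniteDimensional ℚ A]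
    (h𝒟 : ∀ L : V →ₗ[ℚ] V, L ∈ 𝒟 ↔ (∀ a ∈ A, L a ∈ A) ∧ ∀ (i : ι) (a : V), a ∈ A → L (T i a) = T i (L a))
    (hℬ : ∀ ψ : V →ₗ[ℚ] V, ψ ∈ ℬ ↔ (∀ a ∈ A, ψ a ∈ A) ∧
      ∀ (L : ↥𝒟) (a : V), a ∈ A → ψ ((L : V →ₗ[ℚ] V) a) = (L : V →ₗ[ℚ] V) (ψ a))
    (hAst : ∀ (i : ι) (v : V), v ∈ A → T i v ∈ A)
    (hAirr : ∀ W : Submodule ℚ V, W ≤ A → W ≠ ⊥ → (∀ (i : ι) (v : V), v ∈ W → T i v ∈ W) → W = A)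
    {a a' : V} (ha : a ∈ A) (ha0 : a ≠ 0) (ha' : a' ∈ A) (ha'0 : a' ≠ 0) :
    Module.finrank ℚ ↥((𝒟 ⊓ ℬ).map (LinearMap.applyₗ a)) =
      Module.finrank ℚ ↥((𝒟 ⊓ ℬ).map (LinearMap.applyₗ a')) :=
  finrank_map_applyₗ_eq (fun m : ↥(Submonoid.closure (Set.range T ∪ (𝒟 : Set (V →ₗ[ℚ] V)))) => (m : V →ₗ[ℚ] V))
    (mem_centre_iff_commute_closure T h𝒟 hℬ hAst) (exists_closure_eq_id T 𝒟) (exists_closure_eq_comp T 𝒟)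
    (fun m v hv => closure_apply_mem T h𝒟 hAst m.2 v hv) (closure_irreducible T hAirr) ha ha0 ha' ha'0

/-- **`ζ ∣ δ`: `dim Z·a₀ ∣ dim D·a₀`** — the D-line `D·a₀ ≤ A` is stable under the centre (file C1), and `ζ` divides
the dimension of every `Z`-stable subspace of `A` (file C3 for `⟨T, 𝒟⟩`). [cite: CurtisReiner1962, §68]
[cite: Lang2002, XVII §1] [cite: Herstein1994, §4] -/
theorem finrank_map_applyₗ_centre_dvd_finrank_map_applyₗ {𝒟 ℬ : Submodule ℚ (V →ₗ[ℚ] V)} {A : Submodule ℚ V}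
    [FiniteDimensional ℚ A]
    (h𝒟 : ∀ L : V →ₗ[ℚ] V, L ∈ 𝒟 ↔ (∀ a ∈ A, L a ∈ A) ∧ ∀ (i : ι) (a : V), a ∈ A → L (T i a) = T i (L a))
    (hℬ : ∀ ψ : V →ₗ[ℚ] V, ψ ∈ ℬ ↔ (∀ a ∈ A, ψ a ∈ A) ∧
      ∀ (L : ↥𝒟) (a : V), a ∈ A → ψ ((L : V →ₗ[ℚ] V) a) = (L : V →ₗ[ℚ] V) (ψ a))
    (hAst : ∀ (i : ι) (v : V), v ∈ A → T i v ∈ A)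
    (hAirr : ∀ W : Submodule ℚ V, W ≤ A → W ≠ ⊥ → (∀ (i : ι) (v : V), v ∈ W → T i v ∈ W) → W = A)
    {a₀ : V} (ha₀ : a₀ ∈ A) (h0 : a₀ ≠ 0) :
    Module.finrank ℚ ↥((𝒟 ⊓ ℬ).map (LinearMap.applyₗ a₀)) ∣ Module.finrank ℚ ↥(𝒟.map (LinearMap.applyₗ a₀)) :=
  finrank_map_applyₗ_dvd_finrank_of_stable
    (fun m : ↥(Submonoid.closure (Set.range T ∪ (𝒟 : Set (V →ₗ[ℚ] V)))) => (m : V →ₗ[ℚ] V))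
    (mem_centre_iff_commute_closure T h𝒟 hℬ hAst) (exists_closure_eq_id T 𝒟) (exists_closure_eq_comp T 𝒟)
    (fun m v hv => closure_apply_mem T h𝒟 hAst m.2 v hv) (closure_irreducible T hAirr) ha₀ h0
    (map_applyₗ_le T h𝒟 ha₀) fun z v hv => map_applyₗ_stable T h𝒟 a₀ ⟨z.1, (Submodule.mem_inf.1 z.2).1⟩ v hv

/-- **`dim Z|_A = ζ`**: the restriction of the centre to `A` has the dimension of any of its lines (evaluation at
`a₀ ≠ 0` is injective on it; file K1 for `⟨T, 𝒟⟩`). [cite: Lang2002, XVII §1 Prop. 1.1] -/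
theorem finrank_map_domRestrict'_centre_eq {𝒟 ℬ : Submodule ℚ (V →ₗ[ℚ] V)} {A : Submodule ℚ V}
    [FiniteDimensional ℚ A]
    (h𝒟 : ∀ L : V →ₗ[ℚ] V, L ∈ 𝒟 ↔ (∀ a ∈ A, L a ∈ A) ∧ ∀ (i : ι) (a : V), a ∈ A → L (T i a) = T i (L a))
    (hℬ : ∀ ψ : V →ₗ[ℚ] V, ψ ∈ ℬ ↔ (∀ a ∈ A, ψ a ∈ A) ∧
      ∀ (L : ↥𝒟) (a : V), a ∈ A → ψ ((L : V →ₗ[ℚ] V) a) = (L : V →ₗ[ℚ] V) (ψ a))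
    (hAst : ∀ (i : ι) (v : V), v ∈ A → T i v ∈ A)
    (hAirr : ∀ W : Submodule ℚ V, W ≤ A → W ≠ ⊥ → (∀ (i : ι) (v : V), v ∈ W → T i v ∈ W) → W = A)
    {a₀ : V} (ha₀ : a₀ ∈ A) (h0 : a₀ ≠ 0) :
    Module.finrank ℚ ↥((𝒟 ⊓ ℬ).map (LinearMap.domRestrict' A)) =
      Module.finrank ℚ ↥((𝒟 ⊓ ℬ).map (LinearMap.applyₗ a₀)) :=
  finrank_map_domRestrict'_commutant_eq
    (fun m : ↥(Submonoid.closure (Set.range T ∪ (𝒟 : Set (V →ₗ[ℚ] V)))) => (m : V →ₗ[ℚ] V))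
    (mem_centre_iff_commute_closure T h𝒟 hℬ hAst) (fun m v hv => closure_apply_mem T h𝒟 hAst m.2 v hv)
    (closure_irreducible T hAirr) ha₀ h0

/-- **THE DEGREE OF THE CENTRE DIVIDES `δ`: `dim Z|_A ∣ dim D·a₀`** (`= dim 𝒟|_A`, file K1) — `𝒟|_A` is a vector space
over the field `Z|_A`. [cite: CurtisReiner1962, §68] [cite: Herstein1994, §4] [cite: Lang2002, XVII §1] -/
theorem finrank_map_domRestrict'_centre_dvd {𝒟 ℬ : Submodule ℚ (V →ₗ[ℚ] V)} {A : Submodule ℚ V}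
    [FiniteDimensional ℚ A]
    (h𝒟 : ∀ L : V →ₗ[ℚ] V, L ∈ 𝒟 ↔ (∀ a ∈ A, L a ∈ A) ∧ ∀ (i : ι) (a : V), a ∈ A → L (T i a) = T i (L a))
    (hℬ : ∀ ψ : V →ₗ[ℚ] V, ψ ∈ ℬ ↔ (∀ a ∈ A, ψ a ∈ A) ∧
      ∀ (L : ↥𝒟) (a : V), a ∈ A → ψ ((L : V →ₗ[ℚ] V) a) = (L : V →ₗ[ℚ] V) (ψ a))
    (hAst : ∀ (i : ι) (v : V), v ∈ A → T i v ∈ A)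
    (hAirr : ∀ W : Submodule ℚ V, W ≤ A → W ≠ ⊥ → (∀ (i : ι) (v : V), v ∈ W → T i v ∈ W) → W = A)
    {a₀ : V} (ha₀ : a₀ ∈ A) (h0 : a₀ ≠ 0) :
    Module.finrank ℚ ↥((𝒟 ⊓ ℬ).map (LinearMap.domRestrict' A)) ∣
      Module.finrank ℚ ↥(𝒟.map (LinearMap.applyₗ a₀)) := by
  rw [finrank_map_domRestrict'_centre_eq T h𝒟 hℬ hAst hAirr ha₀ h0]
  exact finrank_map_applyₗ_centre_dvd_finrank_map_applyₗ T h𝒟 hℬ hAst hAirr ha₀ h0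

/-- **`dim Z|_A ∣ dim 𝒟|_A`** (both restricted to `A`; K1's `dim 𝒟|_A = δ`). [cite: CurtisReiner1962, §68]
[cite: Herstein1994, §4] -/
theorem finrank_map_domRestrict'_centre_dvd_commutant {𝒟 ℬ : Submodule ℚ (V →ₗ[ℚ] V)} {A : Submodule ℚ V}
    [FiniteDimensional ℚ A]
    (h𝒟 : ∀ L : V →ₗ[ℚ] V, L ∈ 𝒟 ↔ (∀ a ∈ A, L a ∈ A) ∧ ∀ (i : ι) (a : V), a ∈ A → L (T i a) = T i (L a))
    (hℬ : ∀ ψ : V →ₗ[ℚ] V, ψ ∈ ℬ ↔ (∀ a ∈ A, ψ a ∈ A) ∧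
      ∀ (L : ↥𝒟) (a : V), a ∈ A → ψ ((L : V →ₗ[ℚ] V) a) = (L : V →ₗ[ℚ] V) (ψ a))
    (hAst : ∀ (i : ι) (v : V), v ∈ A → T i v ∈ A)
    (hAirr : ∀ W : Submodule ℚ V, W ≤ A → W ≠ ⊥ → (∀ (i : ι) (v : V), v ∈ W → T i v ∈ W) → W = A)
    (hA : A ≠ ⊥) :
    Module.finrank ℚ ↥((𝒟 ⊓ ℬ).map (LinearMap.domRestrict' A)) ∣
      Module.finrank ℚ ↥(𝒟.map (LinearMap.domRestrict' A)) := by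
  obtain ⟨a₀, ha₀, h0⟩ := Submodule.exists_mem_ne_zero_of_ne_bot hA
  rw [finrank_map_domRestrict'_commutant_eq T h𝒟 hAst hAirr ha₀ h0]
  exact finrank_map_domRestrict'_centre_dvd T h𝒟 hℬ hAst hAirr ha₀ h0

/-- **`dim Z|_A ∣ dim A`** (`A` is a vector space over the field `Z|_A`; file C1 for `⟨T, 𝒟⟩`).
[cite: Lang2002, XVII §1 Prop. 1.1] [cite: Herstein1994, §4] -/
theorem finrank_map_domRestrict'_centre_dvd_finrank {𝒟 ℬ : Submodule ℚ (V →ₗ[ℚ] V)} {A : Submodule ℚ V}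
    [FiniteDimensional ℚ A]
    (h𝒟 : ∀ L : V →ₗ[ℚ] V, L ∈ 𝒟 ↔ (∀ a ∈ A, L a ∈ A) ∧ ∀ (i : ι) (a : V), a ∈ A → L (T i a) = T i (L a))
    (hℬ : ∀ ψ : V →ₗ[ℚ] V, ψ ∈ ℬ ↔ (∀ a ∈ A, ψ a ∈ A) ∧
      ∀ (L : ↥𝒟) (a : V), a ∈ A → ψ ((L : V →ₗ[ℚ] V) a) = (L : V →ₗ[ℚ] V) (ψ a))
    (hAst : ∀ (i : ι) (v : V), v ∈ A → T i v ∈ A)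
    (hAirr : ∀ W : Submodule ℚ V, W ≤ A → W ≠ ⊥ → (∀ (i : ι) (v : V), v ∈ W → T i v ∈ W) → W = A)
    {a₀ : V} (ha₀ : a₀ ∈ A) (h0 : a₀ ≠ 0) :
    Module.finrank ℚ ↥((𝒟 ⊓ ℬ).map (LinearMap.domRestrict' A)) ∣ Module.finrank ℚ A := by
  rw [finrank_map_domRestrict'_centre_eq T h𝒟 hℬ hAst hAirr ha₀ h0]
  exact finrank_map_applyₗ_dvd_finrank
    (fun m : ↥(Submonoid.closure (Set.range T ∪ (𝒟 : Set (V →ₗ[ℚ] V)))) => (m : V →ₗ[ℚ] V))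
    (mem_centre_iff_commute_closure T h𝒟 hℬ hAst) (exists_closure_eq_id T 𝒟) (exists_closure_eq_comp T 𝒟)
    (fun m v hv => closure_apply_mem T h𝒟 hAst m.2 v hv) (closure_irreducible T hAirr) ha₀ h0

/-- **Packaged**: there are `e, e′` with `δ = dim Z|_A · e` and `dim A = dim Z|_A · e′` (`e = dim_Z D`,
`e′ = dim_Z A`; `0 ≠ a₀ ∈ A` names `δ`). [cite: CurtisReiner1962, §68] -/
theorem exists_finrank_centre_mul_eq {𝒟 ℬ : Submodule ℚ (V →ₗ[ℚ] V)} {A : Submodule ℚ V} [FiniteDimensional ℚ A]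
    (h𝒟 : ∀ L : V →ₗ[ℚ] V, L ∈ 𝒟 ↔ (∀ a ∈ A, L a ∈ A) ∧ ∀ (i : ι) (a : V), a ∈ A → L (T i a) = T i (L a))
    (hℬ : ∀ ψ : V →ₗ[ℚ] V, ψ ∈ ℬ ↔ (∀ a ∈ A, ψ a ∈ A) ∧
      ∀ (L : ↥𝒟) (a : V), a ∈ A → ψ ((L : V →ₗ[ℚ] V) a) = (L : V →ₗ[ℚ] V) (ψ a))
    (hAst : ∀ (i : ι) (v : V), v ∈ A → T i v ∈ A)
    (hAirr : ∀ W : Submodule ℚ V, W ≤ A → W ≠ ⊥ → (∀ (i : ι) (v : V), v ∈ W → T i v ∈ W) → W = A)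
    {a₀ : V} (ha₀ : a₀ ∈ A) (h0 : a₀ ≠ 0) :
    ∃ e e' : ℕ, Module.finrank ℚ ↥(𝒟.map (LinearMap.applyₗ a₀)) =
        Module.finrank ℚ ↥((𝒟 ⊓ ℬ).map (LinearMap.domRestrict' A)) * e ∧
      Module.finrank ℚ A = Module.finrank ℚ ↥((𝒟 ⊓ ℬ).map (LinearMap.domRestrict' A)) * e' := by
  obtain ⟨e, he⟩ := finrank_map_domRestrict'_centre_dvd T h𝒟 hℬ hAst hAirr ha₀ h0
  obtain ⟨e', he'⟩ := finrank_map_domRestrict'_centre_dvd_finrank T h𝒟 hℬ hAst hAirr ha₀ h0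
  exact ⟨e, e', he, he'⟩

/-- **`dim Z|_A ∣ dim span(T)|_A`** (`T` closed under composition with identity, `A ≠ 0`): `span(T)|_A` has dimension
`c²·δ` where `dim A = c·δ` (K1's Wedderburn count `dim span(T)|_A · δ = (dim A)²` and C1's `δ ∣ dim A`), and `dim Z|_A ∣ δ`
— the restricted operator algebra is a vector space over the centre. [cite: CurtisReiner1962, §68]
[cite: Lang2002, XVII §3] [cite: Herstein1994, §4] -/
theorem finrank_map_domRestrict'_centre_dvd_span {𝒟 ℬ : Submodule ℚ (V →ₗ[ℚ] V)} {A : Submodule ℚ V}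
    [FiniteDimensional ℚ A]
    (h𝒟 : ∀ L : V →ₗ[ℚ] V, L ∈ 𝒟 ↔ (∀ a ∈ A, L a ∈ A) ∧ ∀ (i : ι) (a : V), a ∈ A → L (T i a) = T i (L a))
    (hℬ : ∀ ψ : V →ₗ[ℚ] V, ψ ∈ ℬ ↔ (∀ a ∈ A, ψ a ∈ A) ∧
      ∀ (L : ↥𝒟) (a : V), a ∈ A → ψ ((L : V →ₗ[ℚ] V) a) = (L : V →ₗ[ℚ] V) (ψ a))
    (h1 : ∃ i₀ : ι, T i₀ = LinearMap.id) (hmul : ∀ i i' : ι, ∃ i'' : ι, T i'' = T i ∘ₗ T i')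
    (hAst : ∀ (i : ι) (v : V), v ∈ A → T i v ∈ A)
    (hAirr : ∀ W : Submodule ℚ V, W ≤ A → W ≠ ⊥ → (∀ (i : ι) (v : V), v ∈ W → T i v ∈ W) → W = A)
    (hA : A ≠ ⊥) :
    Module.finrank ℚ ↥((𝒟 ⊓ ℬ).map (LinearMap.domRestrict' A)) ∣
      Module.finrank ℚ ↥((Submodule.span ℚ (Set.range T)).map (LinearMap.domRestrict' A)) := by
  obtain ⟨a₀, ha₀, h0⟩ := Submodule.exists_mem_ne_zero_of_ne_bot hA
  have hζ := finrank_map_domRestrict'_centre_dvd T h𝒟 hℬ hAst hAirr ha₀ h0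
  have hcount := finrank_map_domRestrict'_span_mul_eq T h𝒟 h1 hmul hAst hAirr ha₀ h0
  obtain ⟨c, hc⟩ := finrank_map_applyₗ_dvd_finrank T h𝒟 h1 hmul hAst hAirr ha₀ h0
  haveI : FiniteDimensional ℚ ↥(𝒟.map (LinearMap.applyₗ a₀)) :=
    Submodule.finiteDimensional_of_le (map_applyₗ_le T h𝒟 ha₀)
  have hδ : 0 < Module.finrank ℚ ↥(𝒟.map (LinearMap.applyₗ a₀)) :=
    Nat.pos_of_ne_zero fun h' => map_applyₗ_ne_bot T h𝒟 h0 (Submodule.finrank_eq_zero.1 h')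
  have hs : Module.finrank ℚ ↥((Submodule.span ℚ (Set.range T)).map (LinearMap.domRestrict' A)) =
      c * (Module.finrank ℚ ↥(𝒟.map (LinearMap.applyₗ a₀)) * c) :=
    Nat.eq_of_mul_eq_mul_right hδ (by rw [hcount, hc]; ring)
  rw [hs]
  exact Dvd.dvd.mul_left (dvd_mul_of_dvd_left hζ c) c

end Summit.HodgeConjecture.CorCM.IrrOdd

end
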